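import Summits.NavierStokesRegularity.FluidComputer.PalasekTowerStrainShadowedRunSharp
import Summits.NavierStokesRegularity.FluidComputer.PalasekTowerHeredityWitnessCalibration

/-!
# THE PRICE OF THE NUMERAL STRAIN DOOR: the admissible `L²` defect of a certificate is
# `(E₀ + G₂ T) · e^{∫Γ} ≤ ¼ h^{3/4} ≤ ¼ (216.72 (2B_w+1))^{−3/2}` — at the `wide` register `≤ 10⁻⁹ · e^{−∫Γ}`

Cell `ns-blowup`, seat `ns-blowup-fc-prover-3` (g10; bears_on LADDER-NS N1, route `PalasekTowerBreakdown`, line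
`straindoor`, certificate road (ii) route (A); register-generic arithmetic + the `wide` instance of the aside crux
stmt-NavierStokesRegularity-19179). LABEL: kernel arithmetic about the HYPOTHESES of the numeral door
`StrainShadowSharp.exists_freeRun_near_of_strain` (p529071); theorems only, no definition, no named fact, no
`sorry`. WHAT THIS IS NOT: not Navier–Stokes evidence — it prices a door; no run, design or certificate is
exhibited; no verdict on any item.

* `window_le_of_sharp` — the short-window condition `(24·9.03·(2B_w+1))² h ≤ 1` is `h ≤ (216.72 (2B_w+1))^{−2}`;
* `budget_le_of_sharp_threshold` — the window threshold `2((E₀ + G₂T)e^{I} + 4G₂h) h^{−3/4} ≤ δ ≤ 1/2` forces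
  `(E₀ + G₂T) e^{I} ≤ ¼ h^{3/4}` (`I = ∫₀ᵀ Γ`);
* `budget_le_of_sharp_door` — together: `(E₀ + G₂T) e^{I} ≤ ¼ ((216.72 (2B_w+1))^{−2})^{3/4}`;
* `budget_le_at_wide` — a reference meeting the `wide` speed face has `B_w ≥ Y₁ > 2778`
  (`TowerRates.wide_Y_one_bounds`), so `h ≤ 10^{−12}` and the TOTAL `L²` DEFECT obeys
  `(E₀ + G₂ T) ≤ 10^{−9} · e^{−∫Γ}`: nine digits times the strain fee — versus `¼ e^{−15700}` for the
  sup-norm door (`Germ.defect_le_exp_neg_of_door_hypothesis`, p517152).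

References: S. Palasek, arXiv:2605.13827 §4 [cite: Palasek2026ElementaryModel, §4]; M. Dashti, J. C. Robinson,
SIAM J. Numer. Anal. 46 (2008) [cite: DashtiRobinson2008, Thm. 5].
-/

noncomputable section

namespace Summit.NavierStokesRegularity.FluidComputer.PalasekTowerClayBridge.StrainShadowSharp

open Real

/-- **The short window in closed form**: `(24·9.03·(2B_w+1))² h ≤ 1` with `B_w > 0` gives
`h ≤ 1 / (216.72 (2B_w+1))²`. [cite: Palasek2026ElementaryModel, §4] -/
theorem window_le_of_sharp {Bw h : ℝ} (hBw : 0 < Bw)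
    (hTs : (24 * (9.03 : ℝ) * (Bw + 1 + Bw)) ^ 2 * h ≤ 1) :
    h ≤ 1 / (216.72 * (2 * Bw + 1)) ^ 2 := by
  have hpos : 0 < (216.72 * (2 * Bw + 1)) ^ 2 := by positivity
  rw [le_div_iff₀ hpos]
  have e : (24 * (9.03 : ℝ) * (Bw + 1 + Bw)) ^ 2 = (216.72 * (2 * Bw + 1)) ^ 2 := by ring
  rw [← e]
  linarith

/-- **The window threshold forces an `L²` budget**: if `G₂ ≥ 0`, `h > 0`, `δ ≤ 1/2` and
`2 ((E₀ + G₂ T) e^{I} + 4 G₂ h) h^{−3/4} ≤ δ`, then `(E₀ + G₂ T) e^{I} ≤ ¼ h^{3/4}`.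
[cite: DashtiRobinson2008, Thm. 5] -/
theorem budget_le_of_sharp_threshold {E₀ G₂r T h δ I : ℝ} (hG : 0 ≤ G₂r) (hh : 0 < h) (hδ : δ ≤ 1 / 2)
    (hδ₂ : 2 * ((E₀ + G₂r * T) * Real.exp I + 4 * G₂r * h) * h ^ (-(3 / 4 : ℝ)) ≤ δ) :
    (E₀ + G₂r * T) * Real.exp I ≤ 1 / 4 * h ^ (3 / 4 : ℝ) := by
  have hh34 : 0 < h ^ (3 / 4 : ℝ) := Real.rpow_pos_of_pos hh _
  have hinv : h ^ (-(3 / 4 : ℝ)) = (h ^ (3 / 4 : ℝ))⁻¹ := Real.rpow_neg hh.le _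
  rw [hinv] at hδ₂
  have h1 : 2 * ((E₀ + G₂r * T) * Real.exp I + 4 * G₂r * h) ≤ δ * h ^ (3 / 4 : ℝ) := by
    have := mul_le_mul_of_nonneg_right hδ₂ hh34.le
    rwa [mul_assoc, inv_mul_cancel₀ hh34.ne', mul_one] at this
  have h2 : 0 ≤ 4 * G₂r * h := by positivity
  nlinarith

/-- **The `L²` budget of the numeral strain door in closed form**: under its window and threshold
hypotheses, `(E₀ + G₂ T) e^{I} ≤ ¼ · ((216.72 (2B_w+1))^{−2})^{3/4}` (`= ¼ (216.72 (2B_w+1))^{−3/2}`).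
[cite: Palasek2026ElementaryModel, §4] [cite: DashtiRobinson2008, Thm. 5] -/
theorem budget_le_of_sharp_door {Bw E₀ G₂r T h δ I : ℝ} (hBw : 0 < Bw) (hG : 0 ≤ G₂r) (hh : 0 < h)
    (hTs : (24 * (9.03 : ℝ) * (Bw + 1 + Bw)) ^ 2 * h ≤ 1) (hδ : δ ≤ 1 / 2)
    (hδ₂ : 2 * ((E₀ + G₂r * T) * Real.exp I + 4 * G₂r * h) * h ^ (-(3 / 4 : ℝ)) ≤ δ) :
    (E₀ + G₂r * T) * Real.exp I ≤ 1 / 4 * (1 / (216.72 * (2 * Bw + 1)) ^ 2) ^ (3 / 4 : ℝ) := by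
  have h1 := budget_le_of_sharp_threshold hG hh hδ hδ₂
  have h2 := window_le_of_sharp hBw hTs
  have h3 : h ^ (3 / 4 : ℝ) ≤ (1 / (216.72 * (2 * Bw + 1)) ^ 2) ^ (3 / 4 : ℝ) :=
    Real.rpow_le_rpow hh.le h2 (by norm_num)
  linarith

/-- **THE PRICE AT THE `wide` REGISTER.** A reference meeting the speed face of the letter has
`B_w ≥ Y₁ > 2778` (`TowerRates.wide_Y_one_bounds`); then the window is `h ≤ 10^{−12}` and the total `L²`
defect of an admissible certificate satisfies `(E₀ + G₂ T) · e^{∫Γ} ≤ 10^{−9}` — i.e.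
`E₀ + G₂ T ≤ 10^{−9} e^{−∫Γ}`, nine decimal digits times the STRAIN fee (the sup-norm door demanded
`¼ e^{−15700}`, p517152). [cite: Palasek2026ElementaryModel, §4] -/
theorem budget_le_at_wide {Bw E₀ G₂r T h δ I : ℝ} (hBw : TowerRates.wide.Y 1 ≤ Bw) (hG : 0 ≤ G₂r)
    (hh : 0 < h) (hTs : (24 * (9.03 : ℝ) * (Bw + 1 + Bw)) ^ 2 * h ≤ 1) (hδ : δ ≤ 1 / 2)
    (hδ₂ : 2 * ((E₀ + G₂r * T) * Real.exp I + 4 * G₂r * h) * h ^ (-(3 / 4 : ℝ)) ≤ δ) :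
    h ≤ 1 / 10 ^ 12 ∧ (E₀ + G₂r * T) * Real.exp I ≤ 1 / 10 ^ 9 := by
  obtain ⟨hY, -⟩ := TowerRates.wide_Y_one_bounds
  have hBw0 : 0 < Bw := by linarith
  have hw := window_le_of_sharp hBw0 hTs
  have hbig : (10 : ℝ) ^ 12 ≤ (216.72 * (2 * Bw + 1)) ^ 2 := by nlinarith
  have hh12 : h ≤ 1 / 10 ^ 12 :=
    hw.trans (one_div_le_one_div_of_le (by positivity) hbig)
  refine ⟨hh12, ?_⟩
  have h1 := budget_le_of_sharp_threshold hG hh hδ hδ₂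
  -- `h ≤ (10⁻³)⁴` so `h^{3/4} ≤ (10⁻³)³`
  have ha : h ≤ ((1 : ℝ) / 10 ^ 3) ^ 4 := by
    refine hh12.trans (le_of_eq ?_); norm_num
  have h34 : h ^ (3 / 4 : ℝ) ≤ ((1 : ℝ) / 10 ^ 3) ^ 3 := by
    have h2 : h ^ (3 / 4 : ℝ) ≤ ((((1 : ℝ) / 10 ^ 3) ^ 4) ^ (3 / 4 : ℝ)) :=
      Real.rpow_le_rpow hh.le ha (by norm_num)
    have h3 : ((((1 : ℝ) / 10 ^ 3) ^ 4) ^ (3 / 4 : ℝ)) = ((1 : ℝ) / 10 ^ 3) ^ 3 := by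
      rw [← Real.rpow_natCast ((1 : ℝ) / 10 ^ 3) 4, ← Real.rpow_mul (by positivity),
        ← Real.rpow_natCast ((1 : ℝ) / 10 ^ 3) 3]
      norm_num
    rw [h3] at h2
    exact h2
  calc (E₀ + G₂r * T) * Real.exp I ≤ 1 / 4 * h ^ (3 / 4 : ℝ) := h1
    _ ≤ 1 / 4 * ((1 : ℝ) / 10 ^ 3) ^ 3 := by gcongr
    _ ≤ 1 / 10 ^ 9 := by norm_num

end Summit.NavierStokesRegularity.FluidComputer.PalasekTowerClayBridge.StrainShadowSharp

end
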